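import Summits.QuantumFields.QCD.Theses.NestedDissectionSea
import Summits.QuantumFields.QCD.Theorems.EarlyCrosserLaw.Negative.CellPositivityDomain

/-!
# Line `kac-rice-hermitian-dos` — skeleton for the crux `EarlyCrosserLaw` (stmt-QuantumFields-13995)

Route `NestedDissectionSea`, crux `Summit.QuantumFields.QCD.Theses.NestedDissectionSea.EarlyCrosserLaw`
(rank 2): `∃` ONE admissible regularisation … `∀ m > M₀ ∃ R` with (a′) WINDOW DILUTION OF EARLY
CROSSERS (outer phase-quenched probability of "the window box or one of its 16 children has
`det wilsonCell U μ' = 0` at some `μ' ≥ m_f(k)`" is `≤ δ_j`, `Σ_j δ_j ≤ ε`), (b) the LOWER parity pin,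
(b″) the UPPER parity pin.  Idea card `Cruxes/EarlyCrosserLaw/Ideas/kac-rice-hermitian-dos.md`
(crux-ideate r1, ideator 2; triage r1-1/2/3: pass, with the mandatory re-typing of its first lemma).

## The line (fixed-resolution Kac–Rice = a mass NET; triage r1-2 sharpen 2, r1-1 (i)–(ii), r1-3)

* EXACT PART (proved below, `cellQuasimode_of_det_eq_zero`): the bare mass enters the Dirichlet
  cell additively, `D_c(μ) = D_c(μ') + (μ - μ')·1`, so a kernel vector `w` of `D_c(μ')` is an EXACT
  `|μ - μ'|`-quasimode of `D_c(μ)`: `‖D_c(μ) w‖₂ = |μ - μ'| ‖w‖₂`.  Since `Γ₅` is unitary,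
  `‖Γ₅ D_c(μ) w‖ = ‖D_c(μ) w‖`: "the Hermitian Wilson cell operator `Γ₅·wilsonCell U μ` has an
  eigenvalue in `[-η, η]`" is the same event as "`wilsonCell U μ` has a singular value `≤ η`" — the
  card's DENSITY OF STATES AT ZERO of the Hermitian pencil is the pseudospectral (singular-value)
  count of the cell, and no `Γ₅` needs to be typed.  Hence, for ANY finite cover of the early
  interval `[m_f(k), -e_X(s)]` (`e_X(s) = Σ_i (1 - cos(π/s_i))`, the Dirichlet kinetic edge: no cell
  or child crosses above `-e_X(s)`, stub `stub_kineticEdge` = route support `KineticEdge` (a)) by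
  intervals `[μc_i - ηc_i, μc_i + ηc_i]`, the cover event of (a′) is contained in the finite union of
  the QUASIMODE EVENTS `CellQuasimode U (μc i) cell (ηc i)` over cover points × {parent, 16 children}.
* TRANSFER `C⁺` (stub `stub_pseudospectralCoverLaw`, load-bearing): for every admissible
  regularisation whose line is two-sidedly PINNED, window cells admit such covers whose summed
  single-event phase-quenched probabilities are window-summable (`≤ δ_j`, `Σ δ_j ≤ ε`) — a law for a
  LINEAR STATISTIC of one-point pseudospectral (= Hermitian, variational: min–max for `D_c†D_c`,
  Dirichlet bracketing, Wegner/Lifshitz-tail technology) events at finitely many FIXED masses, in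
  place of a law for real eigenvalues of the non-normal cell operator sweeping a half-line of masses
  (for which only the signed count is a priori constrained, GLR 2005 (5.2.4)).  The cover is the
  prover's (per cell): coarse far from the line where the nominal gap `≍ μ - m_c` is large, fine
  (radius `≍ a_k m/Z_m`) near the valence mass, empty radius-budget on small cells where
  `e_X(s) > |m_f(k)|` (events deterministically empty).
* PIN (stub `stub_twoSidedPin`): the two-sided parity pin (b) ∧ (b″) as its own named node (triage
  r1-3 panel note P1), with (b″) asked on every band `[R, 2R]`, `R ≥ R₀` (so that the `R` of the crux
  can be taken `max R₀ R₁`).  By `Disproof.lean` § 2 `trivial_without_lowerPin` the lower pin is the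
  only content-bearing clause of the crux: in this skeleton it is threaded VERBATIM from
  `stub_twoSidedPin` into the crux, and `stub_pseudospectralCoverLaw` is CONDITIONAL on the pin
  (on a junk line `m_crit ≡ 1` its events are empty and it holds vacuously — the content sits where
  § 2 says it must).
* MEASURE (stub `stub_quasimodeUnionBound`): the phase-quenched ratio functional `P` of the crux is
  monotone-subadditive over finite unions of quasimode events (closed, hence measurable, events of
  the compact configuration space; `P ≡ 0` in every junk case of the ratio) — the Markov/union step
  turning the outer bound of (a′) into the linear statistic of `C⁺`.
* COMPOSITION `EarlyCrosserLaw_of` (sorry-free): unpack the pin witness, feed it to the cover law,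
  re-base `M₀ := M₁`, `R := max R₀ R₁`, and prove (a′) from the cover clause by the exact part +
  kinetic edge (children via `halfSides_le` and antitonicity of `cos` on `[0, π]`) + union bound.

Dropped from the card on the triage record: the IMS / "one Compton block" collapse (r1-1 (ii),
r1-3: `R(k) = C′Z_m(k)/(a_k m)` exceeds every window-cell side eventually since `Z_m → ∞`, so it
never bites; the law is stated PER CELL), the `η → 0` Kac–Rice `liminf` (r1-1/r1-2: junk-typed; the
net needs no limit), the tight-pair residual (α2) (r1-2 sharpen 2: a net charges pairs at face value).

Checked against the landed Negative lemmas (`Theorems/EarlyCrosserLaw/Negative/CellPositivityDomain`,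
p74201): `stub_kineticEdge` gives `μ' ≤ -e_X(s) ≤ 0` (consistent with `wilsonCell_det_ne_zero_of_pos`)
and is TIGHT on the one-site cell `s = (2,2,2,2)` (`e_X = 4`, `μ' = -4` exactly:
`wilsonCell_two_det_eq_zero_iff`); no stub asserts a crossing or quasimode at positive bare mass.
-/

noncomputable section

open scoped BigOperators Classical
open Matrix Complex Filter MeasureTheory
open Literature.MathematicalPhysics.QuantumLattice Literature.MathematicalPhysics.QuantumFieldTheory
  Literature.Probability.LatticeModels
open Summit.QuantumFields.QCD.Theses.NestedDissectionSea

namespace Summit.QuantumFields.QCD.Cruxes.EarlyCrosserLaw.KacRiceHermitianDos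

/-- Local notation: the colour group `SU(3)`. -/
local notation "𝔾" => Matrix.specialUnitaryGroup (Fin 3) ℂ

/-! ## Vocabulary of the line -/

/-- **Quasimode event** (pseudospectral / Hermitian small-eigenvalue event): the Dirichlet cell
`wilsonCell U μ x s` has an `ℓ²`-quasimode of tolerance `η`, i.e. a singular value `≤ |η|`;
equivalently the Hermitian cell operator `Γ₅ · wilsonCell U μ x s` has an eigenvalue in `[-|η|, |η|]`
(`Γ₅` is unitary and site/colour-diagonal).  Sums are explicit so that the norm is Euclidean. -/
def CellQuasimode {N : ℕ} [NeZero N] (U : GaugeConfig 4 N 𝔾) (μ : ℝ) (x : TorusSite 4 N)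
    (s : Fin 4 → ℕ) (η : ℝ) : Prop :=
  ∃ w : {p // wilsonBox x s p} → ℂ, w ≠ 0 ∧
    ∑ p, ‖(wilsonCell U μ x s *ᵥ w) p‖ ^ 2 ≤ η ^ 2 * ∑ p, ‖w p‖ ^ 2

/-- Clause (a′) of the crux (window dilution of early crossers), VERBATIM, as a predicate of the
data `(Nf, reg, b₀, ℓ, m, R)` (same text as the standing disprover's `Disproof.DilutionClause`). -/
def DilutionClause (Nf : ℕ) (reg : QCDRegularisation Nf) (b₀ : ℕ) (ℓ : ℝ) (m : Fin Nf → ℝ)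
    (R : ℝ) : Prop :=
  (∀ ε : ℝ, 0 < ε → ∀ᶠ k : ℕ in Filter.atTop, ∀ S : ℕ, R ≤ reg.a k * (2 * S + 1) → let N : ℕ := 2 * S + 1; let mq : Fin Nf → ℝ := fun f => reg.mcrit k + reg.a k * m f / reg.Zm k; let wt : GaugeConfig 4 N (Matrix.specialUnitaryGroup (Fin 3) ℂ) → ℝ := fun U => ∏ f, ‖fermionDet (wilsonDirac (fundamentalRep (Fin 3)) U (mq f) 1)‖; let P : (GaugeConfig 4 N (Matrix.specialUnitaryGroup (Fin 3) ℂ) → Prop) → ℝ := fun E => (∫ U, (if E U then (1 : ℝ) else 0) * wt U ∂(wilsonMeasure (d := 4) (L := N) (fundamentalRep (Fin 3)) (reg.β k))) / (∫ U, wt U ∂(wilsonMeasure (d := 4) (L := N) (fundamentalRep (Fin 3)) (reg.β k))); let J : ℕ := Nat.log 2 (⌊ℓ / reg.a k⌋₊ / b₀) + 1; ∃ δ : ℕ → ℝ, (∀ j, 0 ≤ δ j) ∧ ∑ j ∈ Finset.range J, δ j ≤ ε ∧ ∀ j < J, ∀ s : Fin 4 → ℕ, (∀ i, b₀ * 2 ^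 j ≤ s i ∧ s i < b₀ * 2 ^ (j + 2) ∧ s i ≤ N ∧ (s i : ℝ) * reg.a k ≤ ℓ) → ∀ E : GaugeConfig 4 N (Matrix.specialUnitaryGroup (Fin 3) ℂ) → Prop, (∀ U, E U → ∃ f : Fin Nf, ∃ μ' : ℝ, mq f ≤ μ' ∧ ((wilsonCell U μ' 0 s).det = 0 ∨ ∃ c : Fin 4 → Bool, (wilsonCell U μ' (halfCorner s c) (halfSides s c)).det = 0)) → P E ≤ δ j)

/-- Clause (b) of the crux (the LOWER parity pin), VERBATIM, as a predicate of `(Nf, reg, M₀, m, R)`. -/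
def LowerPin (Nf : ℕ) (reg : QCDRegularisation Nf) (M₀ : ℝ) (m : Fin Nf → ℝ) (R : ℝ) : Prop :=
  (∀ M : ℝ, M₀ < M → ∀ᶠ k : ℕ in Filter.atTop, ∀ S : ℕ, R ≤ reg.a k * (2 * S + 1) → let N : ℕ := 2 * S + 1; let mq : Fin Nf → ℝ := fun f => reg.mcrit k + reg.a k * m f / reg.Zm k; let wt : GaugeConfig 4 N (Matrix.specialUnitaryGroup (Fin 3) ℂ) → ℝ := fun U => ∏ f, ‖fermionDet (wilsonDirac (fundamentalRep (Fin 3)) U (mq f) 1)‖; (1 / 4 : ℝ) ≤ (∫ U, (if (fermionDet (wilsonDirac (fundamentalRep (Fin 3)) U (reg.mcrit k - reg.a k * M / reg.Zm k) 1)).re < 0 then (1 : ℝ) else 0) * wt U ∂(wilsonMeasure (d := 4) (L := N) (fundamentalRep (Fin 3)) (reg.β k))) / (∫ U, wt U ∂(wilsonMeasure (d := 4) (L := N) (fundamentalRep (Fin 3)) (reg.β k))))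

/-- Clause (b″) of the crux (the UPPER parity pin), VERBATIM, as a predicate of `(Nf, reg, M₀, m, R)`. -/
def UpperPin (Nf : ℕ) (reg : QCDRegularisation Nf) (M₀ : ℝ) (m : Fin Nf → ℝ) (R : ℝ) : Prop :=
  (∀ M : ℝ, M₀ < M → ∀ᶠ k : ℕ in Filter.atTop, ∀ S : ℕ, R ≤ reg.a k * (2 * S + 1) → reg.a k * (2 * S + 1) ≤ 2 * R → let N : ℕ := 2 * S + 1; let mq : Fin Nf → ℝ := fun f => reg.mcrit k + reg.a k * m f / reg.Zm k; let wt : GaugeConfig 4 N (Matrix.specialUnitaryGroup (Fin 3) ℂ) → ℝ := fun U => ∏ f, ‖fermionDet (wilsonDirac (fundamentalRep (Fin 3)) U (mq f) 1)‖; (∫ U, (if (fermionDet (wilsonDirac (fundamentalRep (Fin 3)) U (reg.mcrit k + reg.a k * M / reg.Zm k) 1)).re < 0 then (1 : ℝ) else 0) * wt U ∂(wilsonMeasure (d := 4) (L := N) (fundamentalRep (Fin 3)) (reg.β k))) / (∫ U, wt U ∂(wilsonMeasure (d := 4) (L := N) (fundamentalRep (Fin 3)) (reg.β k))) ≤ (1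 / 8 : ℝ))

/-- The crux is definitionally its clause decomposition (certifies the verbatim copies). -/
theorem earlyCrosserLaw_iff_clauses :
    Summit.QuantumFields.QCD.Theses.NestedDissectionSea.EarlyCrosserLaw ↔
      ∀ Nf : ℕ, (Nf = 2 ∨ Nf = 3) → ∃ reg : QCDRegularisation Nf, reg.HasMassScaling ∧
        (reg.scheme 0 0 0).HasAsymptoticScaling ∧ ∃ M₀ : ℝ, 0 ≤ M₀ ∧ ∃ b₀ : ℕ, 2 ≤ b₀ ∧
        ∃ ℓ : ℝ, 0 < ℓ ∧ ∀ m : Fin Nf → ℝ, (∀ f, M₀ < m f) → ∃ R : ℝ, 0 < R ∧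
          DilutionClause Nf reg b₀ ℓ m R ∧ LowerPin Nf reg M₀ m R ∧ UpperPin Nf reg M₀ m R :=
  Iff.rfl

/-- **Two-sidedly pinned line** (interface between the pin stub and the cover-law stub): for every
mass tuple above `M₀` there is a physical size `R₀` such that on EVERY `R ≥ R₀` the lower pin (b)
holds on tori of side `≥ R` and the upper pin (b″) on the band `[R, 2R]` — `m_crit(k)` is the jump
line of the parity observable up to `± a_k M₀ / Z_m(k)`, from both sides. -/
def Pinned (Nf : ℕ) (reg : QCDRegularisation Nf) (M₀ : ℝ) : Prop :=
  ∀ m : Fin Nf → ℝ, (∀ f, M₀ < m f) → ∃ R₀ : ℝ, 0 < R₀ ∧ ∀ R : ℝ, R₀ ≤ R →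
    LowerPin Nf reg M₀ m R ∧ UpperPin Nf reg M₀ m R

/-- **Pseudospectral cover clause** (the transferred form `C⁺` of (a′), data `(Nf, reg, b₀, ℓ, m, R)`):
same `∀ ε ∀ᶠ k ∀ S` prefix, same phase-quenched functional `P`, same window and `δ`-budget as (a′);
for every window cell `s` there is a FINITE COVER `{[μc i - ηc i, μc i + ηc i]}_{i < n}` of the early
interval `[m_f(k), -e_X(s)]` of every flavour (`e_X(s) = Σ_i (1 - cos(π / s_i))`) such that the SUM
over cover points × {parent (corner `0`, sides `s`), the 16 children (`halfCorner`, `halfSides`)} of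
the probabilities of the single quasimode events `CellQuasimode U (μc i) cell (ηc i)` is `≤ δ_j`. -/
def CoverClause (Nf : ℕ) (reg : QCDRegularisation Nf) (b₀ : ℕ) (ℓ : ℝ) (m : Fin Nf → ℝ)
    (R : ℝ) : Prop :=
  (∀ ε : ℝ, 0 < ε → ∀ᶠ k : ℕ in Filter.atTop, ∀ S : ℕ, R ≤ reg.a k * (2 * S + 1) → let N : ℕ := 2 * S + 1; let mq : Fin Nf → ℝ := fun f => reg.mcrit k + reg.a k * m f / reg.Zm k; let wt : GaugeConfig 4 N (Matrix.specialUnitaryGroup (Fin 3) ℂ) → ℝ := fun U => ∏ f, ‖fermionDet (wilsonDirac (fundamentalRep (Fin 3)) U (mq f) 1)‖; let P : (GaugeConfig 4 N (Matrix.specialUnitaryGroup (Fin 3) ℂ) → Prop) → ℝ := fun E => (∫ U, (if E U then (1 : ℝ) else 0) * wt U ∂(wilsonMeasure (d := 4) (L := N) (fundamentalRep (Fin 3)) (reg.β k))) / (∫ U, wt U ∂(wilsonMeasure (d := 4) (L := N) (fundamentalRep (Fin 3)) (reg.β k))); let J : ℕ := Nat.log 2 (⌊ℓ / reg.a k⌋₊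 / b₀) + 1; ∃ δ : ℕ → ℝ, (∀ j, 0 ≤ δ j) ∧ ∑ j ∈ Finset.range J, δ j ≤ ε ∧ ∀ j < J, ∀ s : Fin 4 → ℕ, (∀ i, b₀ * 2 ^ j ≤ s i ∧ s i < b₀ * 2 ^ (j + 2) ∧ s i ≤ N ∧ (s i : ℝ) * reg.a k ≤ ℓ) → ∃ n : ℕ, ∃ μc ηc : Fin n → ℝ, (∀ f : Fin Nf, ∀ t : ℝ, mq f ≤ t → t ≤ -(∑ i, (1 - Real.cos (Real.pi / s i))) → ∃ i : Fin n, |t - μc i| ≤ ηc i) ∧ ∑ q : Fin n × Option (Fin 4 → Bool), P (fun U => CellQuasimode U (μc q.1) (q.2.elim (0 : TorusSite 4 N) (halfCorner s)) (q.2.elim s (halfSides s)) (ηc q.1)) ≤ δ j)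

/-! ## The registered stubs -/

/-- **stub 1 — TWO-SIDED PARITY PIN** (physics: Yang–Mills topology surviving the continuum limit
with dynamical Wilson quarks; shared by every line on this crux, Disproof § 2).  For `N_f ∈ {2, 3}`
there is ONE mass-independent admissible regularisation (`HasMassScaling`, `HasAsymptoticScaling`)
and `M₀ ≥ 0` such that for every mass tuple above `M₀`, on every physical size `R ≥ R₀(m)`: a distance
`M > M₀` BELOW the line the torus determinant is negative with phase-quenched probability `≥ 1/4` on
all odd tori of side `≥ R` (b), and a distance `M > M₀` ABOVE it with probability `≤ 1/8` on the band
`[R, 2R]` (b″), eventually in `k` — i.e. topological activity `P(Q odd) ≥ 1/4` on physical tori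
(`χ_t R⁴ ≳ 0.35`) below, and Mohler–Schaefer's `⟨n_neg⟩ → 0` per fixed physical volume above.
Why it might fail: index modes crossing over a band `≫ a_k M₀/Z_m` (pin band too narrow), or loss
of topological activity along the sequence. [MohlerSchaefer2020 pp. 7–8; EdwardsHellerNarayanan1998;
Luscher1982Topology] -/
theorem stub_twoSidedPin :
    ∀ Nf : ℕ, (Nf = 2 ∨ Nf = 3) → ∃ reg : QCDRegularisation Nf, reg.HasMassScaling ∧
      (reg.scheme 0 0 0).HasAsymptoticScaling ∧ ∃ M₀ : ℝ, 0 ≤ M₀ ∧ Pinned Nf reg M₀ := by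
  sorry

/-- **stub 2 — PSEUDOSPECTRAL COVER LAW ON PINNED LINES** (the Transfer `C⁺`; load-bearing).
For EVERY admissible regularisation whose line is two-sidedly pinned with constant `M₀` there are
`M₁ ≥ M₀`, a leaf size `b₀ ≥ 2` and a physical window `ℓ > 0` such that every mass tuple above `M₁`
has an `R > 0` with the `CoverClause`: window cells carry finite covers of the early interval
`[m_f(k), -e_X(s)]` whose summed quasimode-event probabilities (parent + 16 children) are `≤ δ_j`,
`δ ≥ 0`, `Σ_{j<J} δ_j ≤ ε`, eventually in `k`, on all odd tori of side `≥ R`.  On a junk line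
(`m_f(k) > 0`) the events are empty and the statement is vacuous; its content is at pinned lines.
Why it might fail: Dirichlet WALL quasimodes (domain-wall-type modes on a cold collar of a face)
or bulk pair-collision carriers making `σ_min(D_c(μ)) ≤ ηc` typical for top window cells at masses
inside `(m_c + h, m_c^{tadpole})`, i.e. the pseudospectral event strictly more frequent than the
crossing it covers. [DelDebbioGiustiLuscherPetronzioTantalo2006 = hep-lat/0512021 (gap of |γ₅D_W|
∝ quark mass); GoltermanShamirSvetitsky2005 = hep-lat/0407021 p. 2; BachKurig2012 = arXiv:1009.1949
Thm 2.1; KieburgVerbaarschotZafeiropoulos arXiv:1109.0656 p. 4; MohlerSchaefer2020] -/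
theorem stub_pseudospectralCoverLaw :
    ∀ Nf : ℕ, (Nf = 2 ∨ Nf = 3) → ∀ reg : QCDRegularisation Nf, reg.HasMassScaling →
      (reg.scheme 0 0 0).HasAsymptoticScaling → ∀ M₀ : ℝ, 0 ≤ M₀ → Pinned Nf reg M₀ →
      ∃ M₁ : ℝ, M₀ ≤ M₁ ∧ ∃ b₀ : ℕ, 2 ≤ b₀ ∧ ∃ ℓ : ℝ, 0 < ℓ ∧ ∀ m : Fin Nf → ℝ,
        (∀ f, M₁ < m f) → ∃ R : ℝ, 0 < R ∧ CoverClause Nf reg b₀ ℓ m R := by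
  sorry

/-- **stub 3 — DIRICHLET KINETIC EDGE** (deterministic; = conjunct (a) of the route support
`KineticEdge`, stmt-QuantumFields-13899, see `stub_kineticEdge_of_KineticEdge`): a Dirichlet cell of
corner `x` and sides `s ≤ N` singular at bare mass `μ'` has `-μ' ≥ e_X(s) = Σ_i (1 - cos(π / s_i))`
(numerical range `Re⟨w, D_c w⟩ = μ'‖w‖² + ⟨w, 𝒲_U w⟩`, lattice diamagnetic inequality, bottom of the
free path-graph kinetic term).  Tight on the one-site cell (`e_X = 4`, `μ' = -4`, landed
`EarlyCrosserLawNegative.wilsonCell_two_det_eq_zero_iff`).  It confines the covers of stub 2 to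
`[m_f(k), -e_X(s)]`. [HernandezJansenLuscher1999; Neuberger2000; Sint1994] -/
theorem stub_kineticEdge :
    ∀ (N : ℕ) [NeZero N] (U : GaugeConfig 4 N 𝔾) (s : Fin 4 → ℕ) (μ' : ℝ) (x : TorusSite 4 N),
      (∀ i, s i ≤ N) → (wilsonCell U μ' x s).det = 0 →
        ∑ i, (1 - Real.cos (Real.pi / s i)) ≤ -μ' := by
  sorry

/-- **stub 4 — UNION BOUND FOR THE PHASE-QUENCHED FUNCTIONAL OVER QUASIMODE EVENTS** (measure
theory on `wilsonMeasure`, size M; the Markov/union step of the card): for the crux's ratio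
functional `P` (weight `∏_f |det D_W(U, mq_f)|`, any `β`, any odd torus) and any finite family of
quasimode events, every event contained in their union has `P E ≤ Σ_i P(event_i)`.  Content: the
quasimode events are CLOSED in `U` (compact unit sphere, continuity of `U ↦ wilsonCell U`), hence
measurable; the weight is continuous and bounded; numerators are monotone and subadditive; every
junk case of the ratio (`Z = 0`, non-measurable `E`, infinite measure) has `P E = 0 ≤ Σ`.
[folklore; Bochner-integral conventions of Mathlib] -/
theorem stub_quasimodeUnionBound :
    ∀ (Nf S : ℕ) (β : ℝ) (mq : Fin Nf → ℝ) (ι : Type) [Fintype ι]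
      (x : ι → TorusSite 4 (2 * S + 1)) (sd : ι → Fin 4 → ℕ) (μ η : ι → ℝ)
      (E : GaugeConfig 4 (2 * S + 1) 𝔾 → Prop),
      (∀ U, E U → ∃ i, CellQuasimode U (μ i) (x i) (sd i) (η i)) →
      let N : ℕ := 2 * S + 1; let wt : GaugeConfig 4 N (Matrix.specialUnitaryGroup (Fin 3) ℂ) → ℝ := fun U => ∏ f, ‖fermionDet (wilsonDirac (fundamentalRep (Fin 3)) U (mq f) 1)‖; let P : (GaugeConfig 4 N (Matrix.specialUnitaryGroup (Fin 3) ℂ) → Prop) → ℝ := fun E => (∫ U, (if E U then (1 : ℝ) else 0) * wt U ∂(wilsonMeasure (d := 4) (L := N) (fundamentalRep (Fin 3)) β)) / (∫ U, wt U ∂(wilsonMeasure (d := 4) (L := N) (fundamentalRep (Fin 3)) β)); P E ≤ ∑ i, P (fun U => CellQuasimode U (μ i) (x i) (sd i) (η i)) := by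
  sorry

/-! ## Exact part (sorry-free) -/

section Exact

variable {N : ℕ} [NeZero N]

omit [NeZero N] in
/-- The bare mass enters a Dirichlet cell additively: `D_c(μ) = D_c(μ') + (μ - μ')·1`. -/
theorem wilsonCell_eq_add_smul_one (U : GaugeConfig 4 N 𝔾) (μ μ' : ℝ) (x : TorusSite 4 N)
    (s : Fin 4 → ℕ) :
    wilsonCell U μ x s = wilsonCell U μ' x s + (((μ - μ' : ℝ)) : ℂ) • (1 : Matrix _ _ ℂ) := by
  ext p q
  rw [Matrix.add_apply, Matrix.smul_apply, Matrix.one_apply, smul_eq_mul]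
  simp only [wilsonCell, Matrix.toSquareBlockProp_def, Matrix.of_apply, wilsonDirac]
  by_cases h : p = q
  · have h' : (p : TorusSite 4 N × Fin 3 × Fin 4) = q := congrArg Subtype.val h
    rw [if_pos h', if_pos h', if_pos h]
    push_cast
    ring
  · have h' : (p : TorusSite 4 N × Fin 3 × Fin 4) ≠ q := fun h'' => h (Subtype.ext h'')
    rw [if_neg h', if_neg h', if_neg h]
    ring

/-- **Fixed-resolution Kac–Rice (the exact layer of the line).** A crossing of the cell at bare
mass `μ'` (`det D_c(μ') = 0`) yields, at every mass `μ` with `|μ - μ'| ≤ η`, an `η`-quasimode of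
`D_c(μ)`: the kernel vector itself, `D_c(μ) w = (μ - μ') w`. -/
theorem cellQuasimode_of_det_eq_zero (U : GaugeConfig 4 N 𝔾) {μ' : ℝ} (x : TorusSite 4 N)
    (s : Fin 4 → ℕ) (hdet : (wilsonCell U μ' x s).det = 0) (μ η : ℝ) (hη : |μ - μ'| ≤ η) :
    CellQuasimode U μ x s η := by
  obtain ⟨w, hw0, hw⟩ := Matrix.exists_mulVec_eq_zero_iff.mpr hdet
  refine ⟨w, hw0, ?_⟩
  have key : wilsonCell U μ x s *ᵥ w = (((μ - μ' : ℝ)) : ℂ) • w := by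
    rw [wilsonCell_eq_add_smul_one U μ μ' x s, Matrix.add_mulVec, hw, zero_add,
      Matrix.smul_mulVec, Matrix.one_mulVec]
  have hsum : ∑ p, ‖(wilsonCell U μ x s *ᵥ w) p‖ ^ 2 = |μ - μ'| ^ 2 * ∑ p, ‖w p‖ ^ 2 := by
    rw [key, Finset.mul_sum]
    refine Finset.sum_congr rfl fun p _ => ?_
    rw [Pi.smul_apply, smul_eq_mul, norm_mul, Complex.norm_real, Real.norm_eq_abs, mul_pow]
  rw [hsum]
  have h0 : 0 ≤ ∑ p, ‖w p‖ ^ 2 := Finset.sum_nonneg fun p _ => by positivity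
  exact mul_le_mul_of_nonneg_right (pow_le_pow_left₀ (abs_nonneg _) hη 2) h0

/-- Antitonicity of the kinetic edge in the sides: shrinking a box (sides `t ≤ s`, `t ≥ 1`) raises
`e_X`. Used for the sixteen children (`halfSides s c ≤ s`). -/
theorem kineticEdge_mono {s t : Fin 4 → ℕ} (ht : ∀ i, 1 ≤ t i) (hts : ∀ i, t i ≤ s i) :
    ∑ i, (1 - Real.cos (Real.pi / s i)) ≤ ∑ i, (1 - Real.cos (Real.pi / t i)) := by
  refine Finset.sum_le_sum fun i _ => ?_
  have ht1 : (1 : ℝ) ≤ t i := by exact_mod_cast ht i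
  have htpos : (0 : ℝ) < t i := by linarith
  have hts' : (t i : ℝ) ≤ s i := by exact_mod_cast hts i
  have h1 : Real.pi / s i ≤ Real.pi / t i := div_le_div_of_nonneg_left Real.pi_pos.le htpos hts'
  have h2 : Real.pi / t i ≤ Real.pi := div_le_self Real.pi_pos.le ht1
  have h0 : 0 ≤ Real.pi / s i := div_nonneg Real.pi_pos.le (Nat.cast_nonneg _)
  have := Real.cos_le_cos_of_nonneg_of_le_pi h0 h2 h1
  linarith

/-- Children of a box with sides `≥ 2` have sides `≥ 1`. -/
theorem one_le_halfSides {s : Fin 4 → ℕ} (hs : ∀ i, 2 ≤ s i) (c : Fin 4 → Bool) (i : Fin 4) :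
    1 ≤ halfSides s c i := by
  have := hs i
  unfold halfSides
  split_ifs <;> omega

/-- The pins are monotone in their threshold `M₀`. -/
theorem lowerPin_mono {Nf : ℕ} {reg : QCDRegularisation Nf} {M₀ M₁ : ℝ} {m : Fin Nf → ℝ} {R : ℝ}
    (hM : M₀ ≤ M₁) (h : LowerPin Nf reg M₀ m R) : LowerPin Nf reg M₁ m R :=
  fun M hM₁ => h M (lt_of_le_of_lt hM hM₁)

/-- The pins are monotone in their threshold `M₀`. -/
theorem upperPin_mono {Nf : ℕ} {reg : QCDRegularisation Nf} {M₀ M₁ : ℝ} {m : Fin Nf → ℝ} {R : ℝ}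
    (hM : M₀ ≤ M₁) (h : UpperPin Nf reg M₀ m R) : UpperPin Nf reg M₁ m R :=
  fun M hM₁ => h M (lt_of_le_of_lt hM hM₁)

end Exact

/-- Stub 3 is exactly conjunct (a) of the route support `KineticEdge` (stmt-QuantumFields-13899):
it closes the moment that item closes. -/
theorem stub_kineticEdge_of_KineticEdge
    (h : Summit.QuantumFields.QCD.Theses.NestedDissectionSea.KineticEdge) :
    ∀ (N : ℕ) [NeZero N] (U : GaugeConfig 4 N 𝔾) (s : Fin 4 → ℕ) (μ' : ℝ) (x : TorusSite 4 N),
      (∀ i, s i ≤ N) → (wilsonCell U μ' x s).det = 0 →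
        ∑ i, (1 - Real.cos (Real.pi / s i)) ≤ -μ' :=
  fun N _ U s μ' x hs hd => (h N U s).1 μ' x hs hd

/-! ## The reduction `C⁺ ⇒ (a′)` and the composition -/

/-- **The cover clause implies the dilution clause** (at any larger `R`), given the kinetic edge and
the union bound: every early crosser of the parent or a child at `μ' ∈ [m_f(k), -e_X(s)]` lies in a
cover interval and its kernel vector is an `ηc i`-quasimode at the cover point (exact part), so the
cover event of (a′) is inside the finite union of quasimode events, whose `P` is bounded by the sum. -/
theorem dilutionClause_of_coverClause
    (hKE : ∀ (N : ℕ) [NeZero N] (U : GaugeConfig 4 N 𝔾) (s : Fin 4 → ℕ) (μ' : ℝ) (x : TorusSite 4 N),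
      (∀ i, s i ≤ N) → (wilsonCell U μ' x s).det = 0 →
        ∑ i, (1 - Real.cos (Real.pi / s i)) ≤ -μ')
    (hUB : ∀ (Nf S : ℕ) (β : ℝ) (mq : Fin Nf → ℝ) (ι : Type) [Fintype ι]
      (x : ι → TorusSite 4 (2 * S + 1)) (sd : ι → Fin 4 → ℕ) (μ η : ι → ℝ)
      (E : GaugeConfig 4 (2 * S + 1) 𝔾 → Prop),
      (∀ U, E U → ∃ i, CellQuasimode U (μ i) (x i) (sd i) (η i)) →
      let N : ℕ := 2 * S + 1; let wt : GaugeConfig 4 N (Matrix.specialUnitaryGroup (Fin 3) ℂ) → ℝ := fun U => ∏ f, ‖fermionDet (wilsonDirac (fundamentalRep (Fin 3)) U (mq f) 1)‖; let P : (GaugeConfig 4 N (Matrix.specialUnitaryGroup (Fin 3) ℂ) → Prop) → ℝ := fun E => (∫ U, (if E U then (1 : ℝ) else 0) * wt U ∂(wilsonMeasure (d := 4) (L := N) (fundamentalRep (Fin 3)) β)) / (∫ U, wt U ∂(wilsonMeasure (d := 4) (L := N) (fundamentalRep (Fin 3)) β)); P E ≤ ∑ i, P (fun U => CellQuasimode U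 (μ i) (x i) (sd i) (η i)))
    {Nf : ℕ} {reg : QCDRegularisation Nf} {b₀ : ℕ} (hb₀ : 2 ≤ b₀) {ℓ : ℝ} {m : Fin Nf → ℝ}
    {R₁ R : ℝ} (hR : R₁ ≤ R) (hcc : CoverClause Nf reg b₀ ℓ m R₁) :
    DilutionClause Nf reg b₀ ℓ m R := by
  intro ε hε
  filter_upwards [hcc ε hε] with k hk
  intro S hS
  have hk' := hk S (hR.trans hS)
  dsimp only at hk' ⊢
  obtain ⟨δ, hδ0, hδs, hcell⟩ := hk'
  refine ⟨δ, hδ0, hδs, ?_⟩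
  intro j hj s hs E hE
  obtain ⟨n, μc, ηc, hcover, hsum⟩ := hcell j hj s hs
  have hs2 : ∀ i, 2 ≤ s i := fun i =>
    calc 2 = 2 * 1 := rfl
      _ ≤ b₀ * 2 ^ j := Nat.mul_le_mul hb₀ Nat.one_le_two_pow
      _ ≤ s i := (hs i).1
  have hsN : ∀ i, s i ≤ 2 * S + 1 := fun i => (hs i).2.2.1
  have hEv : ∀ U, E U → ∃ q : Fin n × Option (Fin 4 → Bool),
      CellQuasimode U (μc q.1) (q.2.elim (0 : TorusSite 4 (2 * S + 1)) (halfCorner s))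
        (q.2.elim s (halfSides s)) (ηc q.1) := by
    intro U hU
    obtain ⟨f, μ', hμ', hsing⟩ := hE U hU
    rcases hsing with h | ⟨c, h⟩
    · have hup : μ' ≤ -(∑ i, (1 - Real.cos (Real.pi / s i))) := by
        have := hKE (2 * S + 1) U s μ' 0 hsN h
        linarith
      obtain ⟨i, hi⟩ := hcover f μ' hμ' hup
      rw [abs_sub_comm] at hi
      exact ⟨(i, none), cellQuasimode_of_det_eq_zero U 0 s h _ _ hi⟩
    · have hup : μ' ≤ -(∑ i, (1 - Real.cos (Real.pi / s i))) := by
        have h1 := hKE (2 * S + 1) U (halfSides s c) μ' (halfCorner s c)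
          (fun i => (halfSides_le s c i).trans (hsN i)) h
        have h2 := kineticEdge_mono (s := s) (t := halfSides s c)
          (fun i => one_le_halfSides hs2 c i) (fun i => halfSides_le s c i)
        linarith
      obtain ⟨i, hi⟩ := hcover f μ' hμ' hup
      rw [abs_sub_comm] at hi
      exact ⟨(i, some c), cellQuasimode_of_det_eq_zero U (halfCorner s c) (halfSides s c) h _ _ hi⟩
  have hub := hUB Nf S (reg.β k) (fun f => reg.mcrit k + reg.a k * m f / reg.Zm k)
    (Fin n × Option (Fin 4 → Bool))
    (fun q => q.2.elim (0 : TorusSite 4 (2 * S + 1)) (halfCorner s))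
    (fun q => q.2.elim s (halfSides s)) (fun q => μc q.1) (fun q => ηc q.1) E hEv
  dsimp only at hub
  exact hub.trans hsum

/-- **COMPOSITION.**  The four stubs imply the crux `EarlyCrosserLaw` BY NAME: the pin stub supplies
ONE admissible two-sidedly pinned regularisation; the cover law, applied to it, supplies
`M₁, b₀, ℓ` and per mass tuple a cover clause; re-basing `M₀ := M₁` and `R := max R₀ R₁`, the
dilution clause (a′) follows from the cover clause by the kinetic edge, the exact Kac–Rice layer
and the union bound, and the pins (b), (b″) are threaded verbatim (monotone in the threshold). -/
theorem EarlyCrosserLaw_of :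
    (∀ Nf : ℕ, (Nf = 2 ∨ Nf = 3) → ∃ reg : QCDRegularisation Nf, reg.HasMassScaling ∧
      (reg.scheme 0 0 0).HasAsymptoticScaling ∧ ∃ M₀ : ℝ, 0 ≤ M₀ ∧ Pinned Nf reg M₀) →
    (∀ Nf : ℕ, (Nf = 2 ∨ Nf = 3) → ∀ reg : QCDRegularisation Nf, reg.HasMassScaling →
      (reg.scheme 0 0 0).HasAsymptoticScaling → ∀ M₀ : ℝ, 0 ≤ M₀ → Pinned Nf reg M₀ →
      ∃ M₁ : ℝ, M₀ ≤ M₁ ∧ ∃ b₀ : ℕ, 2 ≤ b₀ ∧ ∃ ℓ : ℝ, 0 < ℓ ∧ ∀ m : Fin Nf → ℝ,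
        (∀ f, M₁ < m f) → ∃ R : ℝ, 0 < R ∧ CoverClause Nf reg b₀ ℓ m R) →
    (∀ (N : ℕ) [NeZero N] (U : GaugeConfig 4 N 𝔾) (s : Fin 4 → ℕ) (μ' : ℝ) (x : TorusSite 4 N),
      (∀ i, s i ≤ N) → (wilsonCell U μ' x s).det = 0 →
        ∑ i, (1 - Real.cos (Real.pi / s i)) ≤ -μ') →
    (∀ (Nf S : ℕ) (β : ℝ) (mq : Fin Nf → ℝ) (ι : Type) [Fintype ι]
      (x : ι → TorusSite 4 (2 * S + 1)) (sd : ι → Fin 4 → ℕ) (μ η : ι → ℝ)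
      (E : GaugeConfig 4 (2 * S + 1) 𝔾 → Prop),
      (∀ U, E U → ∃ i, CellQuasimode U (μ i) (x i) (sd i) (η i)) →
      let N : ℕ := 2 * S + 1; let wt : GaugeConfig 4 N (Matrix.specialUnitaryGroup (Fin 3) ℂ) → ℝ := fun U => ∏ f, ‖fermionDet (wilsonDirac (fundamentalRep (Fin 3)) U (mq f) 1)‖; let P : (GaugeConfig 4 N (Matrix.specialUnitaryGroup (Fin 3) ℂ) → Prop) → ℝ := fun E => (∫ U, (if E U then (1 : ℝ) else 0) * wt U ∂(wilsonMeasure (d := 4) (L := N) (fundamentalRep (Fin 3)) β)) / (∫ U, wt U ∂(wilsonMeasure (d := 4) (L := N) (fundamentalRep (Fin 3)) β)); P E ≤ ∑ i, P (fun U => CellQuasimode U (μ i) (x i) (sd i) (η i))) →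
    Summit.QuantumFields.QCD.Theses.NestedDissectionSea.EarlyCrosserLaw := by
  intro hPin hCov hKE hUB
  rw [earlyCrosserLaw_iff_clauses]
  intro Nf hNf
  obtain ⟨reg, hms, has, M₀, hM₀, hpin⟩ := hPin Nf hNf
  obtain ⟨M₁, hM₁, b₀, hb₀, ℓ, hℓ, hcov⟩ := hCov Nf hNf reg hms has M₀ hM₀ hpin
  refine ⟨reg, hms, has, M₁, hM₀.trans hM₁, b₀, hb₀, ℓ, hℓ, fun m hm => ?_⟩
  have hm₀ : ∀ f, M₀ < m f := fun f => lt_of_le_of_lt hM₁ (hm f)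
  obtain ⟨R₀, hR₀, hpins⟩ := hpin m hm₀
  obtain ⟨R₁, -, hcc⟩ := hcov m hm
  refine ⟨max R₀ R₁, lt_max_of_lt_left hR₀, ?_, ?_, ?_⟩
  · exact dilutionClause_of_coverClause hKE hUB hb₀ (le_max_right R₀ R₁) hcc
  · exact lowerPin_mono hM₁ (hpins (max R₀ R₁) (le_max_left R₀ R₁)).1
  · exact upperPin_mono hM₁ (hpins (max R₀ R₁) (le_max_left R₀ R₁)).2

/-- The registered stubs literally fit the composition: the crux from the four stubs (this
declaration inherits the stubs' `sorry`s and nothing else). -/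
theorem earlyCrosserLaw_of_stubs :
    Summit.QuantumFields.QCD.Theses.NestedDissectionSea.EarlyCrosserLaw :=
  EarlyCrosserLaw_of stub_twoSidedPin stub_pseudospectralCoverLaw
    (fun N _ U s μ' x => stub_kineticEdge N U s μ' x) stub_quasimodeUnionBound

end Summit.QuantumFields.QCD.Cruxes.EarlyCrosserLaw.KacRiceHermitianDos

end
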